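import Literature.Geometry.Riemannian.ShrinkerScalarCurvatureNonneg
import Literature.Geometry.Riemannian.ShrinkerDistanceComparison
import Literature.Geometry.Riemannian.ShrinkerMinimumPrinciple
import HarnessLib

/-!
# Complete gradient shrinkers have `R ≥ 0` (Zhang 2009, Thm. 1.3 (ii)) — the named fact
# `shrinkerScalarCurvature_nonneg` DISCHARGED

`shrinkerScalarCurvature_nonneg_holds : shrinkerScalarCurvature_nonneg`
(`ShrinkerScalarCurvatureNonneg.lean`: Z.-H. Zhang, Proc. AMS 137 (2009) 2755–2759, Thm. 1.3 (ii);
B.-L. Chen, J. Differential Geom. 82 (2009), Cor. 2.5; quoted as (2.6) in Haslhofer–Müller, GAFA 21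
(2011), §2), by Zhang's one-page elliptic argument (proof of Thm. 1.3, Step 1) in its two halves
proved in the tree: `Zhang2009.directionalComparison_core` (`ShrinkerDistanceComparison.lean`: the
weighted Laplacian comparison for `d(p, ·)` along geodesic directions, in second-variation /
upper-barrier form) and `Zhang2009.minimumPrinciple_core`
(`ShrinkerMinimumPrinciple.lean`: the localised minimum principle for `ψ(d/A)·R` with Hamilton's
identity `ΔR = g⁻¹(dR,df) + R − 2|Ric|²`). The regularity instances of the smooth Levi-Civita
connection come from `isLocallyContMDiff_leviCivita_holds`, the dimension from
`finrank_euclideanSpace_fin`; the normalisation `R + |∇f|² = f` of the fact's binder is not used.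

Consequence recorded here: the bundled Haslhofer–Müller fact `shrinkerPotentialGrowth`
(`ShrinkerPotentialGrowth.lean`: (2.6) + Lemma 2.1 + Lemma 2.2) is now reduced to Lemma 2.2 alone
(`shrinkerPotentialGrowth_of_volume`, from the tree's `shrinkerPotentialGrowth_of_nonneg_of_volume`).

## References

* [Zhang2009] Z.-H. Zhang, Proc. AMS 137 (2009) 2755–2759 = arXiv:0807.1581, Thm. 1.3 (ii),
  Prop. 2.2, proof Step 1.
* [Chen2009] B.-L. Chen, J. Differential Geom. 82 (2009) 363–382, Cor. 2.5.
* [HaslhoferMuller2011] R. Haslhofer, R. Müller, GAFA 21 (2011), §2 (2.6), Lemmas 2.1–2.2.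
-/

noncomputable section

open scoped Manifold ContDiff Topology ENNReal NNReal
open Set Filter

namespace Literature.Geometry.Riemannian

open Lorentzian

/-- **Zhang 2009, Thm. 1.3 (ii) / Chen 2009, Cor. 2.5 / Haslhofer–Müller 2011, (2.6) — DISCHARGED**:
every complete connected gradient shrinking Ricci soliton `Ric + Hess f = g/2` (closed `g.edist`-balls
compact, Levi-Civita connection, `f` smooth; the normalisation `R + |∇f|² = f` is carried by the binder
but not used) has nonnegative scalar curvature. Proof: Zhang's Step 1 = the weighted Laplacian
comparison along geodesic directions (`Zhang2009.directionalComparison_core`) fed into the localised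
minimum principle (`Zhang2009.minimumPrinciple_core`).
[cite: Zhang2009, Thm. 1.3 (ii), Prop. 2.2, proof Step 1 (arXiv pp. 3–5)] [cite: Chen2009, Cor. 2.5]
[cite: HaslhoferMuller2011, §2 (2.6) (p. 5)] -/
theorem shrinkerScalarCurvature_nonneg_holds : shrinkerScalarCurvature_nonneg := by
  intro n M _ _ _ _ _ _ _ _ _ g _ f hg hcpt hf hsol _ x
  have hk1 : ((1 : ℕ∞) : ℕ∞ω) + 1 ≤ (∞ : ℕ∞ω) := by
    rw [show ((1 : ℕ∞) : ℕ∞ω) + 1 = 2 by norm_num]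
    exact WithTop.coe_le_coe.2 le_top
  haveI : CovariantDerivative.ContMDiffCovariantDerivative g.leviCivita 1 :=
    ⟨g.isLocallyContMDiff_leviCivita_holds 1 hk1 univ isOpen_univ⟩
  haveI : CovariantDerivative.ContMDiffCovariantDerivative g.leviCivita ∞ :=
    ⟨g.isLocallyContMDiff_leviCivita_holds ⊤ (le_of_eq rfl) univ isOpen_univ⟩
  exact Zhang2009.minimumPrinciple_core g hg hcpt hf hsol
    (fun p ↦ Zhang2009.directionalComparison_core g hg hcpt hf hsol p) x

/-- **Haslhofer–Müller 2011, §2, reduced to Lemma 2.2 alone**: with (2.6) discharged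
(`shrinkerScalarCurvature_nonneg_holds`) and Lemma 2.1 proved from it in the tree
(`shrinkerPotentialGrowth_of_nonneg_of_volume`), the bundled named fact `shrinkerPotentialGrowth`
follows from the volume growth estimate of Lemma 2.2 about every minimum point of the potential,
`Vol{d(p, ·) < r} ≤ C₂(n) rⁿ` (hypothesis `hV`, verbatim the `hV` of
`shrinkerPotentialGrowth_of_nonneg_of_volume`). [cite: HaslhoferMuller2011, §2 (2.6), Lemma 2.1, Lemma 2.2 (p. 5); App. (p. 15)] -/
theorem shrinkerPotentialGrowth_of_volume
    (hV : ∀ n : ℕ, ∃ C₂ : ℝ, ∀ (M : Type) [TopologicalSpace M] [T2Space M]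
      [SecondCountableTopology M] [ChartedSpace (EuclideanSpace ℝ (Fin n)) M]
      [IsManifold (𝓡 n) ∞ M] [ConnectedSpace M] [T3Space M] [MeasurableSpace M] [BorelSpace M]
      (g : PseudoRiemannianMetric (𝓡 n) ∞ (EuclideanSpace ℝ (Fin n)) (TangentSpace (𝓡 n) : M → Type _))
      [g.HasLeviCivita] (f : M → ℝ) (hg : g.IsRiemannian),
      (∀ (x : M) (r : NNReal), IsCompact {y : M | g.edist hg x y ≤ r}) →
      ContMDiff (𝓡 n) 𝓘(ℝ, ℝ) ∞ f →
      (∀ (x : M) (X Y : TangentSpace (𝓡 n) x),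
        g.ricci x X Y + g.hessian f x X Y = (1 / 2 : ℝ) * g.val x X Y) →
      (∀ x : M, g.scalarCurvature x + g.gradSq f x = f x) →
      ∀ p : M, (∀ x : M, f p ≤ f x) →
        ∀ r : NNReal, riemannianMeasure (g.toContMDiffRiemannianMetric hg)
          {x : M | g.edist hg p x < r} ≤ ENNReal.ofReal (C₂ * (r : ℝ) ^ n)) :
    shrinkerPotentialGrowth :=
  HaslhoferMuller.shrinkerPotentialGrowth_of_nonneg_of_volume shrinkerScalarCurvature_nonneg_holds hV

end Literature.Geometry.Riemannian

end
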